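import Summits.QuantumFields.YangMills.Theorems.BalabanUVNodesN08AlphaEq324RowClassSocketApprox
import Literature.MathematicalPhysics.QuantumFieldTheory.Balaban1983to89.B1Eq324BenfattoKernelEq324AnyGamma

/-!
# Route «BalabanUVNodes», Track-A DAG node N08 = [Balaban1985UV3] Thm 1 p. 257 ∕ Thm 2 p. 272 — THE CLASS ROAD ∘ THE (α)-SOCKET, END TO END: the (3.24) row `h324` of the
# edited clauses for EVERY a.e. presentation of the step's fluctuation block by the Gaussian field of a uniformly elliptic, exponentially decaying precision on a finite window of
# `ℤ^d` ([Balaban1985BackgroundPropagators] Sect. E's currency), with a (4.5)-type Hamiltonian of `O(g_k^σ)` coefficients — the class (3.24) theorem of seats n08-b∕-c∕-d∕-w5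
# (`…KernelEq324AnyGamma.eq324_kernel_of_expDecay`, p636283) composed with part 4's post-consumer plug (part 5 of the class socket)

Cell `pub-ymgap`, seat `pub-ymgap-dag-n08-w4` gen 5 (INTENT-6).  `bears_on: R4∕N08`; filed `--supports stmt-QuantumFields-27364` (K1⁹, helper).  THEOREMS ONLY (def-free, sorry-free,
standard axioms); `eq324_kernel_of_expDecay` (dag-n08-b g14, over n08-d's `eq324_kernel_noPad` p635433 ∕ n08-c's `classBasicLemma_signed` ∕ the whole `…KernelSect5*` road) and
`…RowClassSocketApprox.h324Row_freeLetter_of_postConsumer_ae` (p636897) consumed BY NAME.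

WHAT IS PROVED.  ★★★★ `exists_h324Row_freeLetter_of_expDecayPresentation_ae`: fix a group model, a constants record `𝔠`, a lattice dimension `d ≥ 1`, class scalars `γ_A > 0`, `K_A ≥ 0`,
`κ_A > 0` (coercivity ∕ decay of the presenting precisions), Hamiltonian shape `(D, ϰ > 0)`, threshold parameters `b₀ > 0`, `p₀ > 2∕3`, coupling power `σ > 0` with
`6 + 2κ₀ < σ(n̄ + 1)` and `c₀ ≥ 0`.  THEN `∃ η₀ ∈ (0, 1]`, `C ≥ 0` — functions of these scalars ALONE — such that for EVERY lattice approximation `S`, tower data `𝔖`, step `k` with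
`g_k ≤ η₀` and volume factor `v` with `C·v ≤ Ca + Cc`: whenever the step's fluctuation block is presented, per `(h, U)`, by a member — a finite window `Λ h U ⊂ ℤ^d`, a symmetric
`γ_A`-coercive precision `A h U` on it with `|A e e'| ≤ K_A e^{−κ_A|e−e'|₂}`, its zero-extended covariance kernel `K h U`, a measurable `Φ h U` with
`(𝔖 k).μ = (gaussianFieldOfKernel (K h U)).map (Φ h U)`, `(Φ h U)⁻¹'((𝔖 k).box h) =ᵐ smallFieldSet (I h U) (p(g_k))`, `(𝔖 k).𝒱 h U ∘ Φ h U =ᵐ hamiltonian s D ϰ (a h U) (J h U)`,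
`∅ ≠ I h U ⊇ J h U`, `J h U ⊆ Λ h U`, `coefSup ≤ c₀·g_k^σ`, `|I h U| ≤ v·|T₁^{(k)}|` — the row
`∀ h U, Eq324 (∫ ω in (𝔖 k).box h, e^{(𝔖 k).𝒱 h U ω} ∂(𝔖 k).μ) (n ↦ cumulantOf (m ↦ ∫ ((𝔖 k).𝒱 h U ω)^m ∂(𝔖 k).μ) n) 𝔠.nbar (𝔠.Ca + 𝔠.Cc) (Lᵏ·S.g0sq) (3 + 𝔠.κ₀) (S.sites k)` holds —
`StepAlphaEq324CoreLTAtAC.h324` ∕ `StepAlphaEq324CoreLTAt.h324` at the free letter, character for character.  `…_rec_one`: the record's own `b₀, p₀`, `σ = 1`, `5 + 2κ₀ < n̄`.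
So the [B1] (3.24) row of N08's (α) clause on the road of record is REDUCED TO THE IDENT: naming, per `(h, U)`, the window∕precision∕embedding∕cut-off set∕Hamiltonian letters of [B10]'s
`dμ_{C^{(k)}}(Ω_{k+1}, U_{k+1})`, `χ_k`, `𝒱_k` ((22)∕(24) p.261–262, (58) p.270) with Sect.-E bounds uniform in `(h, U, k, S)` — NODE 00 objects; N06 [B9] in-edges for `(γ_A, K_A, κ_A)`;
CHECK C (torus) via part 4 where a wrapped region occurs.
HONEST SCOPE.  A composition by name; every hypothesis above is a HYPOTHESIS; the IDENT is NOT commissioned and NOT claimed; nothing of [Balaban1985UV3] ∕ [BenfattoEtAl1978] ∕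
[Balaban1985BackgroundPropagators] asserted or discharged (the class form of [2]'s Lemma is OURS and PROVED in the tree); `PrintedUV3V` NOT proved; N08 NOT discharged; count-neutral; one
finite 𝕋⁴ programme at fixed ε, d = 3 tori of [B10] inside the record, Bałaban AS PRINTED — R4 closes the conditional finite-𝕋⁴ rung `BalabanLadder.UV` only; nothing about d = 4 continuum
limits, OS axioms, a mass gap or the Clay problem.

References: [Balaban1985UV3] T. Bałaban, CMP 102 (1985) 255–275 — (22)–(24) pp.261–262, (41) p.266, (56)–(58) p.270; [Balaban1982Higgs1] T. Bałaban, CMP 85 (1982) — (3.24) p.616;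
[BenfattoEtAl1978] G. Benfatto et al., CMP 59 (1978) — Lemma p.152; [Balaban1985BackgroundPropagators] T. Bałaban, CMP 99 (1985) 389–434 — Sect. E.
-/

noncomputable section

namespace Summit.QuantumFields.YangMills.Theorems.BalabanUVNodesN08AlphaEq324RowClassSocketEnd

open MeasureTheory
open scoped BigOperators Nat
open Literature.MathematicalPhysics.QuantumFieldTheory (gaussianFieldOfKernel)
open Literature.MathematicalPhysics.QuantumFieldTheory.Balaban1983to89
open Literature.MathematicalPhysics.QuantumFieldTheory.Balaban1983to89.B1Sect3Statements (Eq324)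
open Literature.MathematicalPhysics.QuantumFieldTheory.Balaban1983to89.B1Eq324BenfattoLemma (Coef hamiltonian coefSup smallFieldSet cutoffBoltzmann cumulantSum)
open Literature.MathematicalPhysics.QuantumFieldTheory.Balaban1983to89.B1Eq324BenfattoKernelEq324AnyGamma (eq324_kernel_of_expDecay)
open Literature.MathematicalPhysics.QuantumFieldTheory.Balaban1985CMP102.Setting
open Summit.QuantumFields.Balaban3D.Carriers
open Summit.QuantumFields.Balaban3D.Proofs.ScalesArithmetic (gk_pos)
open Summit.QuantumFields.Balaban3D.Proofs.Primitives (AlphaConsts)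
open Summit.QuantumFields.Balaban3D.Proofs.GroupModelLieC (lieC)
open Summit.QuantumFields.YangMills.Theorems.BalabanUVNodesN08AlphaEq324RowClassSocketApprox (h324Row_freeLetter_of_postConsumer_ae)
open Literature.Probability.LatticeModels (cumulantOf)

variable {L : ℕ} {G : Type} [GaugeGroup G] [MeasurableSpace G] [HaarData G] (𝔊 : GroupModel G) (𝔠 : AlphaConsts L 𝔊.N) {d : ℕ}

/-- ★★★★ **THE (3.24) ROW OF THE EDITED (α) CLAUSES FOR EVERY A.E. PRESENTATION OF THE STEP BLOCK BY A UNIFORMLY ELLIPTIC, EXPONENTIALLY DECAYING GAUSSIAN MEMBER** (the class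
road's `eq324_kernel_of_expDecay` ∘ the socket's `h324Row_freeLetter_of_postConsumer_ae`; statement in the module docstring).  `η₀, C` depend only on
`(d, γ_A, K_A, κ_A, D, ϰ, b₀, p₀, σ, c₀, n̄, κ₀)`; everything about the member, the embedding, the cut-off set and the Hamiltonian letters may depend on `(h, U)`.
[cite: Balaban1985UV3, (22)–(24) pp.261–262 + (41) p.266 + (58) p.270; Balaban1982Higgs1, (3.24) p.616; BenfattoEtAl1978, Lemma p.152 (class form; ours); Balaban1985BackgroundPropagators, Sect. E] -/
theorem exists_h324Row_freeLetter_of_expDecayPresentation_ae (hd : 0 < d) {γA KA κA : ℝ} (hγA0 : 0 < γA) (hKA : 0 ≤ KA) (hκA : 0 < κA)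
    (D : ℕ) {ϰ : ℝ} (hϰ : 0 < ϰ) {b₀ p₀ σ c₀ : ℝ} (hb₀ : 0 < b₀) (hp₀ : 2 / 3 < p₀) (hσ : 0 < σ) (hc₀ : 0 ≤ c₀) (hκσ : 6 + 2 * 𝔠.κ₀ < σ * (𝔠.nbar + 1)) :
    ∃ η₀ C : ℝ, 0 < η₀ ∧ η₀ ≤ 1 ∧ 0 ≤ C ∧
      ∀ (S : Scales L) (𝔖 : ∀ k, StepSeries S G ↥(lieC 𝔊) (nblkOf S 𝔠.lane.carrier k) k) (k : ℕ) (v : ℝ),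
        S.gk k ≤ η₀ → C * v ≤ 𝔠.Ca + 𝔠.Cc →
        ∀ (Λ : Hist S.P (k + 1) → GaugeField S.P (k + 1) G → Finset (Fin d → ℤ))
          (A : ∀ h U, Matrix ↥(Λ h U) ↥(Λ h U) ℝ) (K : Hist S.P (k + 1) → GaugeField S.P (k + 1) G → (Fin d → ℤ) → (Fin d → ℤ) → ℝ)
          (Φ : Hist S.P (k + 1) → GaugeField S.P (k + 1) G → ((Fin d → ℤ) → ℝ) → (𝔖 k).Fl)
          (s : ℕ) (I J : Hist S.P (k + 1) → GaugeField S.P (k + 1) G → Finset (Fin d → ℤ))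
          (a : Hist S.P (k + 1) → GaugeField S.P (k + 1) G → Coef d),
          -- the members (Sect. E currency)
          (∀ h U x y, K h U x y = if hxy : x ∈ Λ h U ∧ y ∈ Λ h U then ((A h U)⁻¹ : Matrix ↥(Λ h U) ↥(Λ h U) ℝ) ⟨x, hxy.1⟩ ⟨y, hxy.2⟩ else 0) →
          (∀ h U, (Λ h U).Nonempty) → (∀ h U e e', A h U e e' = A h U e' e) →
          (∀ h U (x : ↥(Λ h U) → ℝ), γA * ∑ e, x e ^ 2 ≤ ∑ e, ∑ e', A h U e e' * x e * x e') →
          (∀ h U (e e' : ↥(Λ h U)), |A h U e e'| ≤ KA * Real.exp (-(κA * Real.sqrt (∑ j, ((((e : Fin d → ℤ) j : ℝ) - ((e' : Fin d → ℤ) j : ℝ))) ^ 2)))) →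
          -- the a.e. presentation
          (∀ h U, Measurable (Φ h U)) → (∀ h U, (𝔖 k).μ = (gaussianFieldOfKernel (K h U)).map (Φ h U)) →
          (∀ h, MeasurableSet ((𝔖 k).box h)) → (∀ h U, Measurable ((𝔖 k).𝒱 h U)) →
          (∀ h U, Φ h U ⁻¹' (𝔖 k).box h =ᵐ[gaussianFieldOfKernel (K h U)] smallFieldSet (I h U) (B10.pFun b₀ p₀ (S.gk k))) →
          (∀ h U, (fun z => (𝔖 k).𝒱 h U (Φ h U z)) =ᵐ[gaussianFieldOfKernel (K h U)] hamiltonian s D ϰ (a h U) (J h U)) →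
          -- the instance data
          (∀ h U, (I h U).Nonempty) → (∀ h U, J h U ⊆ I h U) → (∀ h U, J h U ⊆ Λ h U) →
          (∀ h U, coefSup s D (a h U) (J h U) ≤ c₀ * S.gk k ^ σ) → (∀ h U, ((I h U).card : ℝ) ≤ v * S.sites k) →
          ∀ h (U : GaugeField S.P (k + 1) G),
            Eq324 (∫ ω in (𝔖 k).box h, Real.exp ((𝔖 k).𝒱 h U ω) ∂(𝔖 k).μ)
              (fun n => cumulantOf (fun m => ∫ ω, (𝔖 k).𝒱 h U ω ^ m ∂(𝔖 k).μ) n) 𝔠.nbar (𝔠.Ca + 𝔠.Cc)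
              ((L : ℝ) ^ k * S.g0sq) (3 + 𝔠.κ₀) (S.sites k) := by
  obtain ⟨η₀, C, hη₀, hη₀1, hC, hE⟩ :=
    eq324_kernel_of_expDecay (d := d) hd hγA0 hKA hκA 𝔠.nbar D hϰ hb₀ hp₀ hσ hc₀ (κ := 6 + 2 * 𝔠.κ₀) (by linarith [𝔠.κ₀_pos]) hκσ
  refine ⟨η₀, C, hη₀, hη₀1, hC, ?_⟩
  intro S 𝔖 k v hgk hCv Λ A K Φ s I J a hK hΛ hAs hγA hdec hΦ hμ hboxm hVm hbox hV hI hJI hJΛ hA hIv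
  refine h324Row_freeLetter_of_postConsumer_ae 𝔊 𝔠 𝔖 k hC hCv (fun h U => gaussianFieldOfKernel (K h U)) Φ hΦ hμ hboxm hVm I hbox
    (fun h U => hamiltonian s D ϰ (a h U) (J h U)) hV hIv fun h U => ?_
  exact hE (S.gk k) (gk_pos S k) hgk (hK h U) (hΛ h U) (hAs h U) (hγA h U) (hdec h U) s (I h U) (J h U) (a h U) (hI h U) (hJI h U) (hJΛ h U) (hA h U)

/-- **… AT THE RECORD's OWN `b₀ = 𝔠.b₀`, `p₀ = 𝔠.p₀` AND PRINT's COUPLING POWER `σ = 1`** (coefficients `O(g_k)`, (56)–(57); `5 + 2κ₀ < n̄`, so `n̄ = 6`).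
[cite: Balaban1985UV3, (7) p.257 + (56)–(58) p.270; Balaban1982Higgs1, (3.24) p.616; BenfattoEtAl1978, Lemma p.152 (class form; ours)] -/
theorem exists_h324Row_freeLetter_of_expDecayPresentation_ae_rec_one (hd : 0 < d) {γA KA κA : ℝ} (hγA0 : 0 < γA) (hKA : 0 ≤ KA) (hκA : 0 < κA)
    (D : ℕ) {ϰ : ℝ} (hϰ : 0 < ϰ) {c₀ : ℝ} (hc₀ : 0 ≤ c₀) (hn : 5 + 2 * 𝔠.κ₀ < 𝔠.nbar) :
    ∃ η₀ C : ℝ, 0 < η₀ ∧ η₀ ≤ 1 ∧ 0 ≤ C ∧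
      ∀ (S : Scales L) (𝔖 : ∀ k, StepSeries S G ↥(lieC 𝔊) (nblkOf S 𝔠.lane.carrier k) k) (k : ℕ) (v : ℝ),
        S.gk k ≤ η₀ → C * v ≤ 𝔠.Ca + 𝔠.Cc →
        ∀ (Λ : Hist S.P (k + 1) → GaugeField S.P (k + 1) G → Finset (Fin d → ℤ))
          (A : ∀ h U, Matrix ↥(Λ h U) ↥(Λ h U) ℝ) (K : Hist S.P (k + 1) → GaugeField S.P (k + 1) G → (Fin d → ℤ) → (Fin d → ℤ) → ℝ)
          (Φ : Hist S.P (k + 1) → GaugeField S.P (k + 1) G → ((Fin d → ℤ) → ℝ) → (𝔖 k).Fl)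
          (s : ℕ) (I J : Hist S.P (k + 1) → GaugeField S.P (k + 1) G → Finset (Fin d → ℤ))
          (a : Hist S.P (k + 1) → GaugeField S.P (k + 1) G → Coef d),
          (∀ h U x y, K h U x y = if hxy : x ∈ Λ h U ∧ y ∈ Λ h U then ((A h U)⁻¹ : Matrix ↥(Λ h U) ↥(Λ h U) ℝ) ⟨x, hxy.1⟩ ⟨y, hxy.2⟩ else 0) →
          (∀ h U, (Λ h U).Nonempty) → (∀ h U e e', A h U e e' = A h U e' e) →
          (∀ h U (x : ↥(Λ h U) → ℝ), γA * ∑ e, x e ^ 2 ≤ ∑ e, ∑ e', A h U e e' * x e * x e') →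
          (∀ h U (e e' : ↥(Λ h U)), |A h U e e'| ≤ KA * Real.exp (-(κA * Real.sqrt (∑ j, ((((e : Fin d → ℤ) j : ℝ) - ((e' : Fin d → ℤ) j : ℝ))) ^ 2)))) →
          (∀ h U, Measurable (Φ h U)) → (∀ h U, (𝔖 k).μ = (gaussianFieldOfKernel (K h U)).map (Φ h U)) →
          (∀ h, MeasurableSet ((𝔖 k).box h)) → (∀ h U, Measurable ((𝔖 k).𝒱 h U)) →
          (∀ h U, Φ h U ⁻¹' (𝔖 k).box h =ᵐ[gaussianFieldOfKernel (K h U)] smallFieldSet (I h U) (B10.pFun 𝔠.b₀ 𝔠.p₀ (S.gk k))) →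
          (∀ h U, (fun z => (𝔖 k).𝒱 h U (Φ h U z)) =ᵐ[gaussianFieldOfKernel (K h U)] hamiltonian s D ϰ (a h U) (J h U)) →
          (∀ h U, (I h U).Nonempty) → (∀ h U, J h U ⊆ I h U) → (∀ h U, J h U ⊆ Λ h U) →
          (∀ h U, coefSup s D (a h U) (J h U) ≤ c₀ * S.gk k) → (∀ h U, ((I h U).card : ℝ) ≤ v * S.sites k) →
          ∀ h (U : GaugeField S.P (k + 1) G),
            Eq324 (∫ ω in (𝔖 k).box h, Real.exp ((𝔖 k).𝒱 h U ω) ∂(𝔖 k).μ)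
              (fun n => cumulantOf (fun m => ∫ ω, (𝔖 k).𝒱 h U ω ^ m ∂(𝔖 k).μ) n) 𝔠.nbar (𝔠.Ca + 𝔠.Cc)
              ((L : ℝ) ^ k * S.g0sq) (3 + 𝔠.κ₀) (S.sites k) := by
  obtain ⟨η₀, C, hη₀, hη₀1, hC, h⟩ :=
    exists_h324Row_freeLetter_of_expDecayPresentation_ae 𝔊 𝔠 (d := d) hd hγA0 hKA hκA D hϰ (b₀ := 𝔠.b₀) (p₀ := 𝔠.p₀) (σ := 1)
      𝔠.b₀_pos (by linarith [𝔠.two_lt_p₀]) one_pos hc₀ (by linarith)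
  refine ⟨η₀, C, hη₀, hη₀1, hC, ?_⟩
  intro S 𝔖 k v hgk hCv Λ A K Φ s I J a hK hΛ hAs hγA hdec hΦ hμ hboxm hVm hbox hV hI hJI hJΛ hA hIv
  exact h S 𝔖 k v hgk hCv Λ A K Φ s I J a hK hΛ hAs hγA hdec hΦ hμ hboxm hVm hbox hV hI hJI hJΛ
    (fun h' U => by rw [Real.rpow_one]; exact hA h' U) hIv

end Summit.QuantumFields.YangMills.Theorems.BalabanUVNodesN08AlphaEq324RowClassSocketEnd

end
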